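import Literature.AnabelianGeometry.SemiGraphs.PSCCoveringDatum
import HarnessLib

/-!
# The covering datum `G_U`: counts and verticial / edge-like subgroups (proofs)

PROOF-ONLY companion of `PSCCoveringDatum.lean` ([CombGC] Def. 1.1 (ii), author's ms pp. 6–7
[cite: MochizukiCombGC2007, Def 1.1(ii) pp.6-7]): for the finite étale `Π_G`-covering datum
`G.restrict U hU : PSCDatum ↥U` of an open subgroup `U ⊆ Π_G` of finite index,

* `restrictGraph_r / _n / _i`: `r(G_U) = cuspCount U`, `n(G_U) = nodeCount U`,
  `i(G_U) = vertCount U` — the counts the interface `PSCFundamentalGroup.lean` attaches to `U` ARE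
  the numbers of cusps / nodes / vertices of the covering datum;
* `restrict_cuspCount / _nodeCount / _vertCount` (`V ≤ U`): the counts of the sub-covering `G_V`
  computed from `G` equal those computed from the datum `G_U` at `V ⊆ U` — via the general
  double-coset fibre bijection `PSCCovering.nonempty_fibreEquiv`
  (`V \ Π / K ≃ Σ_i V' \ U / (U ∩ x_i K x_i⁻¹)'`), `card_doubleCosetQuotient_eq_sum`;
* `isVerticial_restrict_iff` (and `isNodal_…`, `isCuspidal_…`, `isEdgeLike_…`): the verticial
  (nodal, cuspidal, edge-like) subgroups of `Π_{G_U} = U` in the sense of Def. 1.1 (ii) applied to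
  the datum `G_U` are exactly the traces `U ∩ B` of the verticial (…) subgroups `B` of `Π_G`, i.e.
  the interface's `IsVerticialIn U` (…): `isVerticial_restrict_iff_isVerticialIn`.

Pure group theory over the two definition files; no new definitions; no statement here takes a
side on [IUTchIII] Cor. 3.12.
-/

namespace Literature.AnabelianGeometry.SemiGraphs

open scoped Pointwise

universe u

namespace PSCCovering

variable {P : Type u} [Group P] (V U K : Subgroup P) [U.FiniteIndex]

/-- **The cusps of `G_V` fibre over the cusps of `G_U`** (`V ≤ U`): the map
`(i, V' u L_i') ↦ V u x_i K`, `L_i = U ∩ x_i K x_i⁻¹` (primes denote traces on `U`), is a bijection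
`(Σ i, V' \ U / L_i') ≃ V \ Π / K` — `V \ Π / K` is the disjoint union over the double cosets
`U x_i K` of the `V' \ U / (U ∩ x_i K x_i⁻¹)'`. [cite: MochizukiCombGC2007, Def 1.1(ii) p.6] -/
theorem nonempty_fibreEquiv (hV : V ≤ U) :
    Nonempty ((Σ i : dcFin U K, DoubleCoset.Quotient ((V.subgroupOf U : Subgroup U) : Set U)
      (((ConjAct.toConjAct (dcRep U K i) • K).subgroupOf U : Subgroup U) : Set U)) ≃
      DoubleCoset.Quotient (V : Set P) (K : Set P)) := by
  let φ : (Σ i : dcFin U K, DoubleCoset.Quotient ((V.subgroupOf U : Subgroup U) : Set U)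
      (((ConjAct.toConjAct (dcRep U K i) • K).subgroupOf U : Subgroup U) : Set U)) →
      DoubleCoset.Quotient (V : Set P) (K : Set P) := fun q =>
    Quotient.liftOn' q.2 (fun u : U => DoubleCoset.mk V K ((u : P) * dcRep U K q.1)) (by
      intro a b hab
      obtain ⟨v, hv, l, hl, rfl⟩ := DoubleCoset.rel_iff.mp hab
      rw [Subgroup.mem_subgroupOf] at hv hl
      rw [Subgroup.mem_pointwise_smul_iff_inv_smul_mem, ← ConjAct.toConjAct_inv, ConjAct.smul_def,
        ConjAct.ofConjAct_toConjAct, inv_inv] at hl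
      show DoubleCoset.mk V K _ = DoubleCoset.mk V K _
      rw [DoubleCoset.eq]
      refine ⟨v, hv, (dcRep U K q.1)⁻¹ * l * dcRep U K q.1, hl, ?_⟩
      simp only [Subgroup.coe_mul, mul_assoc, mul_inv_cancel_left])
  refine ⟨Equiv.ofBijective φ ⟨?_, ?_⟩⟩
  · rintro ⟨i, a⟩ ⟨j, b⟩ h
    induction a using Quotient.inductionOn' with | h a => ?_
    induction b using Quotient.inductionOn' with | h b => ?_
    change DoubleCoset.mk V K ((a : P) * dcRep U K i) = DoubleCoset.mk V K ((b : P) * dcRep U K j)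
      at h
    obtain ⟨v, hv, k, hk, hb⟩ := (DoubleCoset.eq V K _ _).mp h
    -- same `U`-double coset, hence `i = j`
    have hij : i = j := by
      rw [← dcIdx_dcRep U K i, ← dcIdx_dcRep U K j, dcIdx_eq_iff]
      refine ⟨(b : P)⁻¹ * v * a, U.mul_mem (U.mul_mem (U.inv_mem b.2) (hV hv)) a.2, k, hk, ?_⟩
      rw [eq_inv_mul_of_mul_eq hb]
      simp only [mul_assoc]
    subst hij
    have hb' : (b : P) = v * (a * dcRep U K i) * k * (dcRep U K i)⁻¹ := eq_mul_inv_of_mul_eq hb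
    congr 1
    refine Quotient.sound' (DoubleCoset.rel_iff.mpr ⟨⟨v, hV hv⟩, ?_,
      ⟨(dcRep U K i) * k * (dcRep U K i)⁻¹, ?_⟩, ?_, ?_⟩)
    · rw [Subgroup.mem_subgroupOf]; exact hv
    · -- `x_i k x_i⁻¹ = (v a)⁻¹ b ∈ U`
      have e : dcRep U K i * k * (dcRep U K i)⁻¹ = ((v : P) * a)⁻¹ * b := by
        rw [hb', mul_inv_rev]; simp only [mul_assoc, inv_mul_cancel_left]
      rw [e]
      exact U.mul_mem (U.inv_mem (U.mul_mem (hV hv) a.2)) b.2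
    · rw [Subgroup.mem_subgroupOf, Subgroup.mem_pointwise_smul_iff_inv_smul_mem,
        ← ConjAct.toConjAct_inv, ConjAct.smul_def, ConjAct.ofConjAct_toConjAct, inv_inv]
      simpa only [mul_assoc, inv_mul_cancel_left, inv_mul_cancel, mul_one] using hk
    · apply Subtype.ext
      simp only [Subgroup.coe_mul, hb', mul_assoc]
  · intro q
    induction q using Quotient.inductionOn' with | h g => ?_
    obtain ⟨u, hu, k, hk, hrep⟩ := exists_dcRep_dcIdx_eq U K g
    refine ⟨⟨dcIdx U K g, Quotient.mk'' ⟨u⁻¹, U.inv_mem hu⟩⟩, ?_⟩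
    change DoubleCoset.mk V K _ = DoubleCoset.mk V K g
    rw [DoubleCoset.eq]
    refine ⟨1, V.one_mem, k⁻¹, K.inv_mem hk, ?_⟩
    rw [Subgroup.coe_mk, hrep]
    simp only [mul_assoc, one_mul, inv_mul_cancel_left, mul_inv_cancel, mul_one]

/-- **Sub-coverings fibre over coverings**: for `V ≤ U` of finite index and any `K`,
`#(V \ Π / K) = Σ_i #(V' \ U / (U ∩ x_i K x_i⁻¹)')`, the sum over the enumerated double cosets
`U x_i K`. [cite: MochizukiCombGC2007, Def 1.1(ii) p.6] -/
theorem card_doubleCosetQuotient_eq_sum (hV : V ≤ U) [V.FiniteIndex] :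
    Nat.card (DoubleCoset.Quotient (V : Set P) (K : Set P)) =
      ∑ i : dcFin U K, Nat.card (DoubleCoset.Quotient ((V.subgroupOf U : Subgroup U) : Set U)
        (((ConjAct.toConjAct (dcRep U K i) • K).subgroupOf U : Subgroup U) : Set U)) := by
  haveI : (V.subgroupOf U).FiniteIndex := ⟨fun h0 => Subgroup.FiniteIndex.index_ne_zero (H := V)
    (by rw [← Subgroup.relIndex_mul_index hV]; exact mul_eq_zero_of_left h0 _)⟩
  haveI : ∀ i : dcFin U K, Finite (DoubleCoset.Quotient ((V.subgroupOf U : Subgroup U) : Set U)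
      (((ConjAct.toConjAct (dcRep U K i) • K).subgroupOf U : Subgroup U) : Set U)) :=
    fun i => finite_doubleCosetQuotient _ _
  obtain ⟨e⟩ := nonempty_fibreEquiv V U K hV
  rw [← Nat.card_congr e, Nat.card_sigma]

end PSCCovering

namespace PSCDatum

open PSCCovering

variable {P : Type u} [Group P] [TopologicalSpace P] (G : PSCDatum P) (U : Subgroup P)
  [U.FiniteIndex]

/-! ### Counts -/

/-- `r(G_U) = Σ_c #(U \ Π / Π_c) = cuspCount U`: the cusps of the covering datum are the cusps the
interface counts. [cite: MochizukiCombGC2007, Def 1.1(i)-(ii) p.6] -/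
theorem restrictGraph_r : (G.restrictGraph U).r = G.cuspCount U := by
  show Fintype.card (Σ c : G.graph.C, dcFin U (G.cuspGp c)) = _
  rw [Fintype.card_sigma]
  simp [cuspCount]

/-- `n(G_U) = nodeCount U`. [cite: MochizukiCombGC2007, Def 1.1(i)-(ii) p.6] -/
theorem restrictGraph_n : (G.restrictGraph U).n = G.nodeCount U := by
  show Fintype.card (Σ e : G.graph.N, dcFin U (G.nodeGp e)) = _
  rw [Fintype.card_sigma]
  simp [nodeCount]

/-- `i(G_U) = vertCount U`. [cite: MochizukiCombGC2007, Def 1.1(i)-(ii) p.6] -/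
theorem restrictGraph_i : (G.restrictGraph U).i = G.vertCount U := by
  show Fintype.card (Σ v : G.graph.V, dcFin U (G.vertGp v)) = _
  rw [Fintype.card_sigma]
  simp [vertCount]

variable [IsTopologicalGroup P] (hU : IsOpen (U : Set P))

/-- `r(G_U) = cuspCount U` for the datum. [cite: MochizukiCombGC2007, Def 1.1(i)-(ii) p.6] -/
theorem restrict_graph_r : (G.restrict U hU).graph.r = G.cuspCount U := G.restrictGraph_r U

/-- `n(G_U) = nodeCount U` for the datum. [cite: MochizukiCombGC2007, Def 1.1(i)-(ii) p.6] -/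
theorem restrict_graph_n : (G.restrict U hU).graph.n = G.nodeCount U := G.restrictGraph_n U

/-- `i(G_U) = vertCount U` for the datum. [cite: MochizukiCombGC2007, Def 1.1(i)-(ii) p.6] -/
theorem restrict_graph_i : (G.restrict U hU).graph.i = G.vertCount U := G.restrictGraph_i U

/-! ### Counts of sub-coverings: `G_V → G_U → G` for `V ≤ U` -/

/-- **Cusps of a sub-covering.**  For `V ≤ U` the number of cusps `r(G_V)` computed from `G`
(`G.cuspCount V`) equals the number computed from the covering datum `G_U` at the open subgroup
`V ⊆ U = Π_{G_U}`: the cusps of `G_V` fibre over the cusps of `G_U`.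
[cite: MochizukiCombGC2007, Def 1.1(ii) p.6] -/
theorem restrict_cuspCount (V : Subgroup P) (hV : V ≤ U) [V.FiniteIndex] :
    (G.restrict U hU).cuspCount (V.subgroupOf U) = G.cuspCount V := by
  show (∑ d : (Σ c : G.graph.C, dcFin U (G.cuspGp c)), _) = _
  rw [Fintype.sum_sigma]
  refine Finset.sum_congr rfl fun c _ => ?_
  exact (card_doubleCosetQuotient_eq_sum V U (G.cuspGp c) hV).symm

/-- **Nodes of a sub-covering**: `n(G_V)` from `G` equals `n` of the covering of `G_U` attached to
`V ⊆ U`. [cite: MochizukiCombGC2007, Def 1.1(ii) p.6] -/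
theorem restrict_nodeCount (V : Subgroup P) (hV : V ≤ U) [V.FiniteIndex] :
    (G.restrict U hU).nodeCount (V.subgroupOf U) = G.nodeCount V := by
  show (∑ d : (Σ e : G.graph.N, dcFin U (G.nodeGp e)), _) = _
  rw [Fintype.sum_sigma]
  refine Finset.sum_congr rfl fun e _ => ?_
  exact (card_doubleCosetQuotient_eq_sum V U (G.nodeGp e) hV).symm

/-- **Vertices of a sub-covering**: `i(G_V)` from `G` equals `i` of the covering of `G_U` attached
to `V ⊆ U`. [cite: MochizukiCombGC2007, Def 1.1(ii) p.6] -/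
theorem restrict_vertCount (V : Subgroup P) (hV : V ≤ U) [V.FiniteIndex] :
    (G.restrict U hU).vertCount (V.subgroupOf U) = G.vertCount V := by
  show (∑ w : (Σ v : G.graph.V, dcFin U (G.vertGp v)), _) = _
  rw [Fintype.sum_sigma]
  refine Finset.sum_congr rfl fun v _ => ?_
  exact (card_doubleCosetQuotient_eq_sum V U (G.vertGp v) hV).symm

/-! ### Verticial and edge-like subgroups of `G_U` -/

variable {G U}

omit [TopologicalSpace P] [IsTopologicalGroup P] in
/-- Conjugates of the representatives `y_i K y_i⁻¹ ∩ U` by elements of `U` are exactly the traces of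
all conjugates of `K`: every `g ∈ Π` is `u * y_i * k` (`u ∈ U`, `k ∈ K`) for the representative `y_i`
of its double coset `U g K`. [cite: MochizukiCombGC2007, Def 1.1(ii) p.6] -/
theorem exists_conj_rep_iff {ι : Type*} (K : ι → Subgroup P) (A : Subgroup U) :
    (∃ (i : ι) (j : dcFin U (K i)) (δ : ConjAct U),
        A = δ • (ConjAct.toConjAct (dcRep U (K i) j) • K i).subgroupOf U) ↔
      ∃ B : Subgroup P, (∃ (i : ι) (γ : ConjAct P), B = γ • K i) ∧ A = B.subgroupOf U := by
  constructor
  · rintro ⟨i, j, δ, rfl⟩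
    refine ⟨ConjAct.toConjAct ((ConjAct.ofConjAct δ : U) : P) • ConjAct.toConjAct (dcRep U (K i) j) •
      K i, ⟨i, ConjAct.toConjAct ((ConjAct.ofConjAct δ : U) * dcRep U (K i) j), by
        rw [map_mul, mul_smul]⟩, ?_⟩
    rw [← conj_subgroupOf_eq, ConjAct.toConjAct_ofConjAct]
  · rintro ⟨B, ⟨i, γ, rfl⟩, rfl⟩
    obtain ⟨u, hu, k, hk, hrep⟩ := exists_dcRep_dcIdx_eq U (K i) (ConjAct.ofConjAct γ)
    refine ⟨i, dcIdx U (K i) (ConjAct.ofConjAct γ), ConjAct.toConjAct (⟨u, hu⟩⁻¹ : U), ?_⟩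
    rw [conj_subgroupOf_eq, ← mul_smul, ← map_mul, hrep, Subgroup.coe_inv, Subgroup.coe_mk]
    congr 1
    have hk' : ConjAct.toConjAct k • K i = K i := by
      ext b
      rw [Subgroup.mem_pointwise_smul_iff_inv_smul_mem, ← ConjAct.toConjAct_inv, ConjAct.smul_def,
        ConjAct.ofConjAct_toConjAct, inv_inv]
      constructor
      · intro hb
        have hb' := (K i).mul_mem ((K i).mul_mem hk hb) ((K i).inv_mem hk)
        rwa [show k * (k⁻¹ * b * k) * k⁻¹ = b by simp [mul_assoc]] at hb'
      · exact fun hb => (K i).mul_mem ((K i).mul_mem ((K i).inv_mem hk) hb) hk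
    conv_lhs => rw [← ConjAct.toConjAct_ofConjAct γ]
    rw [show u⁻¹ * (u * ConjAct.ofConjAct γ * k) = ConjAct.ofConjAct γ * k by simp [mul_assoc],
      map_mul, mul_smul, hk']

/-- **Verticial subgroups of `Π_{G_U} = U`** (Def. 1.1 (ii) applied to the datum `G_U`) are exactly
the traces `U ∩ B` of the verticial subgroups `B` of `Π_G`. [cite: MochizukiCombGC2007, Def 1.1(ii) p.6] -/
theorem isVerticial_restrict_iff (A : Subgroup U) :
    (G.restrict U hU).IsVerticial A ↔ ∃ B, G.IsVerticial B ∧ A = B.subgroupOf U := by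
  have h := exists_conj_rep_iff (U := U) G.vertGp A
  simp only [IsVerticial] at h ⊢
  refine Iff.trans ?_ h
  constructor
  · rintro ⟨w, δ, rfl⟩
    exact ⟨w.1, w.2, δ, rfl⟩
  · rintro ⟨v, j, δ, rfl⟩
    exact ⟨⟨v, j⟩, δ, rfl⟩

/-- **Nodal subgroups of `Π_{G_U} = U`** are the traces `U ∩ B` of the nodal subgroups `B` of `Π_G`.
[cite: MochizukiCombGC2007, Def 1.1(ii) p.7] -/
theorem isNodal_restrict_iff (A : Subgroup U) :
    (G.restrict U hU).IsNodal A ↔ ∃ B, G.IsNodal B ∧ A = B.subgroupOf U := by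
  have h := exists_conj_rep_iff (U := U) G.nodeGp A
  simp only [IsNodal] at h ⊢
  refine Iff.trans ?_ h
  constructor
  · rintro ⟨d, δ, rfl⟩
    exact ⟨d.1, d.2, δ, rfl⟩
  · rintro ⟨e, j, δ, rfl⟩
    exact ⟨⟨e, j⟩, δ, rfl⟩

/-- **Cuspidal subgroups of `Π_{G_U} = U`** are the traces `U ∩ B` of the cuspidal subgroups `B` of
`Π_G` ("the cusps of `G_U` lying over the cusps of `G`"). [cite: MochizukiCombGC2007, Def 1.1(ii) p.7] -/
theorem isCuspidal_restrict_iff (A : Subgroup U) :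
    (G.restrict U hU).IsCuspidal A ↔ ∃ B, G.IsCuspidal B ∧ A = B.subgroupOf U := by
  have h := exists_conj_rep_iff (U := U) G.cuspGp A
  simp only [IsCuspidal] at h ⊢
  refine Iff.trans ?_ h
  constructor
  · rintro ⟨d, δ, rfl⟩
    exact ⟨d.1, d.2, δ, rfl⟩
  · rintro ⟨c, j, δ, rfl⟩
    exact ⟨⟨c, j⟩, δ, rfl⟩

/-- **Edge-like subgroups of `Π_{G_U} = U`** are the traces `U ∩ B` of the edge-like subgroups `B`
of `Π_G`. [cite: MochizukiCombGC2007, Def 1.1(ii) pp.6-7] -/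
theorem isEdgeLike_restrict_iff (A : Subgroup U) :
    (G.restrict U hU).IsEdgeLike A ↔ ∃ B, G.IsEdgeLike B ∧ A = B.subgroupOf U := by
  simp only [IsEdgeLike, isNodal_restrict_iff, isCuspidal_restrict_iff]
  constructor
  · rintro (⟨B, hB, rfl⟩ | ⟨B, hB, rfl⟩)
    · exact ⟨B, Or.inl hB, rfl⟩
    · exact ⟨B, Or.inr hB, rfl⟩
  · rintro ⟨B, hB | hB, rfl⟩
    · exact Or.inl ⟨B, hB, rfl⟩
    · exact Or.inr ⟨B, hB, rfl⟩

omit [TopologicalSpace P] [IsTopologicalGroup P] [U.FiniteIndex] in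
/-- Traces on `U` and the interface's `U ⊓ B`: `A = B ∩ U` as a subgroup of `U` iff its image in
`Π` is `U ⊓ B`. [cite: MochizukiCombGC2007, Def 1.1(ii) p.6] -/
theorem eq_subgroupOf_iff_map_eq (A : Subgroup U) (B : Subgroup P) :
    A = B.subgroupOf U ↔ A.map U.subtype = U ⊓ B := by
  constructor
  · rintro rfl
    rw [Subgroup.subgroupOf_map_subtype, inf_comm]
  · intro h
    have := congrArg (Subgroup.comap U.subtype) h
    rw [Subgroup.comap_map_eq_self_of_injective U.subtype_injective, Subgroup.comap_inf] at this
    rw [this, ← Subgroup.subgroupOf, ← Subgroup.subgroupOf, Subgroup.subgroupOf_self, top_inf_eq]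

/-- The verticial subgroups of the datum `G_U` are the interface's verticial subgroups
`IsVerticialIn U` of the covering attached to `U` (as subgroups of `Π_G`).
[cite: MochizukiCombGC2007, Def 1.1(ii) p.6] -/
theorem isVerticial_restrict_iff_isVerticialIn (A : Subgroup U) :
    (G.restrict U hU).IsVerticial A ↔ G.IsVerticialIn U (A.map U.subtype) := by
  simp only [isVerticial_restrict_iff, IsVerticialIn, eq_subgroupOf_iff_map_eq]

/-- The edge-like subgroups of `G_U` are the interface's `IsEdgeLikeIn U`.
[cite: MochizukiCombGC2007, Def 1.1(ii) pp.6-7] -/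
theorem isEdgeLike_restrict_iff_isEdgeLikeIn (A : Subgroup U) :
    (G.restrict U hU).IsEdgeLike A ↔ G.IsEdgeLikeIn U (A.map U.subtype) := by
  simp only [isEdgeLike_restrict_iff, IsEdgeLikeIn, eq_subgroupOf_iff_map_eq]

/-- The cuspidal subgroups of `G_U` are the interface's `IsCuspidalIn U`.
[cite: MochizukiCombGC2007, Def 1.1(ii) p.7] -/
theorem isCuspidal_restrict_iff_isCuspidalIn (A : Subgroup U) :
    (G.restrict U hU).IsCuspidal A ↔ G.IsCuspidalIn U (A.map U.subtype) := by
  simp only [isCuspidal_restrict_iff, IsCuspidalIn, eq_subgroupOf_iff_map_eq]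

/-- The nodal subgroups of `G_U` are the interface's `IsNodalIn U`.
[cite: MochizukiCombGC2007, Def 1.1(ii) p.7] -/
theorem isNodal_restrict_iff_isNodalIn (A : Subgroup U) :
    (G.restrict U hU).IsNodal A ↔ G.IsNodalIn U (A.map U.subtype) := by
  simp only [isNodal_restrict_iff, IsNodalIn, eq_subgroupOf_iff_map_eq]

/-- In particular the representative `Π_w` of `G_U` at `w = U y Π_v` is the trace `U ∩ y Π_v y⁻¹`
of a verticial subgroup of `Π_G`, as a subgroup of `Π_G`. [cite: MochizukiCombGC2007, Def 1.1(ii) p.6] -/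
theorem restrict_vertGp_map (w : (G.restrictGraph U).V) :
    ((G.restrict U hU).vertGp w).map U.subtype =
      U ⊓ ConjAct.toConjAct (G.vrep U w) • G.vertGp w.1 := by
  rw [restrict_vertGp, Subgroup.subgroupOf_map_subtype, inf_comm]

/-- The representative cuspidal subgroup of `G_U` at `U x Π_c` is `U ∩ x Π_c x⁻¹` in `Π_G`.
[cite: MochizukiCombGC2007, Def 1.1(ii) p.7] -/
theorem restrict_cuspGp_map (d : (G.restrictGraph U).C) :
    ((G.restrict U hU).cuspGp d).map U.subtype =
      U ⊓ ConjAct.toConjAct (G.crep U d) • G.cuspGp d.1 := by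
  rw [restrict_cuspGp, Subgroup.subgroupOf_map_subtype, inf_comm]

/-- The representative nodal subgroup of `G_U` at `U x Π_e` is `U ∩ x Π_e x⁻¹` in `Π_G`.
[cite: MochizukiCombGC2007, Def 1.1(ii) p.7] -/
theorem restrict_nodeGp_map (d : (G.restrictGraph U).N) :
    ((G.restrict U hU).nodeGp d).map U.subtype =
      U ⊓ ConjAct.toConjAct (G.nrep U d) • G.nodeGp d.1 := by
  rw [restrict_nodeGp, Subgroup.subgroupOf_map_subtype, inf_comm]

end PSCDatum

end Literature.AnabelianGeometry.SemiGraphs
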